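/-
Copyright (c) 2026 the pub-hodgecm-mathlib formalisation cell (harness21).  Prover seat hodgecm-mathlib-K2E3-p20 (g0),
Track B «K2-LIT» ∕ h413, line `K2_E3_EllipticInputs`, unit U5Kazhdan, socket #20P (DISC-PL) — rung (R-a) part 1: the FORMAL DEGREE of a
supercuspidal class is choice-free (Harish-Chandra 1970, Part I §1 Theorem 1: «d(π) … depending only on the normalization of the Haar measure»).
2026-09-03.
-/
import Literature.NumberTheory.Automorphic.SchurOrthogonalitySupercuspidal          -- ★ Schur (a): `integral_norm_sq_matrixCoeff_eq` (κ vector-free), `integral_norm_sq_sesqForm_pos`; brings ★ `exists_sesqForm_eq_smul`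
import Summits.HodgeConjecture.HodgeConjecture.Theorems.F0P3cStCharTSScTracePackage    -- ★ E2-5a: the `U(Φ₃)(L⁺_v)` package (`isAdmissible_smoothIrrep`, `nonarchimedeanGroup_Gqs`, `isInvInvariant_haar_Gqs`, `isCompact_center_Gqs` via ParField)
import HarnessLib

/-!
# K2_E3 road (h413 = stmt-HodgeConjecture-24833), socket #20P «DISC-PL» — rung (R-a), part 1: THE FORMAL DEGREE OF A SUPERCUSPIDAL CLASS IS WELL DEFINED

Cell `pub/hodgecm-mathlib` (D-0151), Track B, line `Summits/HodgeConjecture/HodgeConjecture/Cruxes/H413/Lines/K2_E3_EllipticInputs.lean`, unit U5Kazhdan,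
socket #20P `sig_K2E3DiscretePlancherelCuspidal` (cand 619d5b4daf60311c; MEMO-20P-road 6ab33264ff32dae1 §4 (R-a)).  Helper file (`--supports
stmt-HodgeConjecture-24833 --as helper`, no socket closed); THEOREMS ONLY (no `def`, no instance, no notation, no named fact, no `sorry`); ★-only imports.

THE POINT.  (DISC-PL) posits FORMAL DEGREES `d : IrrClass G → ℝ` — a function of the CLASS.  In the tree the formal degree of a supercuspidal `ρ` appears
only through chosen data: a representative `ρ` of the class, an invariant positive-definite Hermitian form `B`, a vector `v ≠ 0`, as the value at `1` of the
normalised coefficient `f_{ρ,B,v} = ((∫ ‖B (ρ x v) v‖² dν) ∕ re B v v)⁻¹ • (g ↦ B (ρ g v) v)` (★ E2-5a), namely `(re B v v)² ∕ ∫ ‖B (ρ x v) v‖² dν` (★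
`inv_smul_sesqForm_apply_self_one`).  Harish-Chandra [1970, Part I §1 Thm 1 (a)]: `d(π)` depends «only on the normalization of the Haar measure».  This file
proves exactly that, in three generic steps and one class-level corollary on `U(Φ₃)(L⁺_v)`:
* §1 **`formalDegree_eq_of_ne_zero`** — independence of the VECTOR: ★ Schur (a) `∫ |B w (ρ x v)|² = κ_{v₀} · re B w w · re B v v` with `κ_{v₀}` free of
  `(v, w)`; **`formalDegree_eq_of_invariant_forms`** — independence of the FORM: two invariant positive-definite Hermitian forms on an irreducible admissible
  `ρ` are proportional (★ `exists_sesqForm_eq_smul`), and the quotient is scale-invariant; **`exists_pullback_form`** — transport of an invariant form along an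
  equivalence `φ : ρ ≃ ρ′` (the pulled-back form has the same values and the same coefficient functions);
* §2 **`exists_formalDegree_of_isSupercuspidal`** — on `G = U(Φ₃)(L⁺_v)` (`v` non-split; centre compact, every class admissible ★, `νQv` inversion-invariant
  ★): for every SUPERCUSPIDAL class `π` there is ONE real `d > 0` with `(re B v v)² ∕ ∫ ‖B (r.ρ x v) v‖² dνQv = d` and `f_{r,B,v}(1) = d` for EVERY representative
  `r` of `π`, EVERY invariant positive-definite Hermitian `B` on `r.V` and EVERY `v ≠ 0` — the formal degree `d(π)` of the CLASS relative to `νQv`.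
Part 2 (separate file) evaluates (DISC-PL) on the span of the normalised supercuspidal coefficients with this class function `d`.
HONEST LABEL: count-neutral; HC_CM is proved only modulo the 7 printed citations (2 remaining named inputs: hLiu418 = stmt-HodgeConjecture-24832, h413 =
stmt-HodgeConjecture-24833) until rung 0 closes; this `--supports` helper retires nothing by itself.

## References
* [HarishChandra1970] Harish-Chandra (notes by G. van Dijk), *Harmonic Analysis on Reductive p-adic Groups*, LNM 162 (1970), Part I §1 Theorem 1 (a).
* [Rogawski1990] J. D. Rogawski, *Automorphic Representations of Unitary Groups in Three Variables*, Ann. of Math. Stud. 123 (1990), §12.6 p. 187, §12.7 p. 194.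
-/

set_option autoImplicit false
-- the mandated namespace has the single-problem summit's repeated segment (`HodgeConjecture.HodgeConjecture`)
set_option linter.dupNamespace false

noncomputable section

open MeasureTheory NumberField IsDedekindDomain
open scoped ComplexConjugate
open Literature.NumberTheory.Automorphic Literature.NumberTheory.Automorphic.UnitaryGroup Literature.NumberTheory.Rogawski1990

namespace Summit.HodgeConjecture.HodgeConjecture.Cruxes.H413.K2E3FormalDegreeSupercuspidalWellDefined

/-! ## §1 Generic carriers: independence of the vector, of the form, and transport along equivalences -/

section Generic

variable {G V : Type*} [Group G] [TopologicalSpace G] [NonarchimedeanGroup G]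
  [LocallyCompactSpace G] [T2Space G] [MeasurableSpace G] [BorelSpace G]
  [AddCommGroup V] [Module ℂ V] {ρ : Representation ℂ G V}

/-- **Independence of the vector.**  For `ρ` irreducible admissible supercuspidal (compact centre), `B` an invariant positive-definite Hermitian form and `ν` an
inversion-invariant Haar measure, the quotient `(re B v v)² ∕ ∫ ‖B (ρ x v) v‖² dν` is the same for all `v ≠ 0` (★ Schur (a): `∫ |B v (ρ x v)|² = κ_w (re B v v)²`
with `κ_w = (∫ ‖B (ρ x w) w‖²) ∕ (re B w w)²`). [cite: HarishChandra1970, Part I §1 Theorem 1 (a)] -/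
theorem formalDegree_eq_of_ne_zero [ρ.IsIrreducible] {B : V →ₗ⋆[ℂ] V →ₗ[ℂ] ℂ} (hadm : ρ.IsAdmissible) (hsc : ρ.IsSupercuspidal)
    (hZ : IsCompact (Subgroup.center G : Set G)) (hBsymm : B.IsSymm) (hBpos : ∀ v : V, v ≠ 0 → 0 < (B v v).re)
    (hBinv : ∀ (g : G) (v w : V), B (ρ g v) (ρ g w) = B v w) (ν : Measure G) [ν.IsHaarMeasure] [ν.IsInvInvariant]
    {v w : V} (hv : v ≠ 0) (hw : w ≠ 0) :
    (B v v).re ^ 2 / ∫ x, ‖B (ρ x v) v‖ ^ 2 ∂ν = (B w w).re ^ 2 / ∫ x, ‖B (ρ x w) w‖ ^ 2 ∂ν := by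
  have h := hsc.integral_norm_sq_matrixCoeff_eq hadm hZ hBsymm hBpos hBinv ν hw v v
  have hsw : (fun x => ‖B v (ρ x v)‖ ^ 2) = fun x => ‖B (ρ x v) v‖ ^ 2 := by
    funext x
    rw [← hBsymm.eq (ρ x v) v, Complex.norm_conj]
  rw [hsw] at h
  have hIw : 0 < ∫ x, ‖B (ρ x w) w‖ ^ 2 ∂ν := hsc.integral_norm_sq_sesqForm_pos hZ hadm.isSmooth hBsymm hBpos hBinv ν hw
  have ha : 0 < (B v v).re := hBpos v hv
  have hb : 0 < (B w w).re := hBpos w hw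
  rw [h]
  field_simp

omit [BorelSpace G] in
/-- **Independence of the form.**  On an irreducible admissible `ρ` two invariant positive-definite Hermitian forms `B`, `B′` are proportional, `B′ = c·B` with
`c = re B′ v v ∕ re B v v > 0` (★ `exists_sesqForm_eq_smul`), so `(re B v v)² ∕ ∫ ‖B (ρ x v) v‖² dν = (re B′ v v)² ∕ ∫ ‖B′ (ρ x v) v‖² dν` for every
measure `ν` and every `v ≠ 0`. [cite: HarishChandra1970, Part I §1 Theorem 1 (a)] -/
theorem formalDegree_eq_of_invariant_forms [ρ.IsIrreducible] {B B' : V →ₗ⋆[ℂ] V →ₗ[ℂ] ℂ} (hadm : ρ.IsAdmissible)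
    (hBsymm : B.IsSymm) (hBpos : ∀ v : V, v ≠ 0 → 0 < (B v v).re) (hBinv : ∀ (g : G) (v w : V), B (ρ g v) (ρ g w) = B v w)
    (hB'symm : B'.IsSymm) (hB'pos : ∀ v : V, v ≠ 0 → 0 < (B' v v).re) (hB'inv : ∀ (g : G) (v w : V), B' (ρ g v) (ρ g w) = B' v w)
    (ν : Measure G) {v : V} (hv : v ≠ 0) :
    (B v v).re ^ 2 / ∫ x, ‖B (ρ x v) v‖ ^ 2 ∂ν = (B' v v).re ^ 2 / ∫ x, ‖B' (ρ x v) v‖ ^ 2 ∂ν := by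
  obtain ⟨c₀, hc₀⟩ := Representation.exists_sesqForm_eq_smul hadm hBinv (Representation.eq_zero_of_sesqForm_self_eq_zero hBpos) B' hB'inv
  -- the constant is the positive real `a′ ∕ a`
  set a : ℝ := (B v v).re with ha
  set a' : ℝ := (B' v v).re with ha'
  have hapos : 0 < a := hBpos v hv
  have ha'pos : 0 < a' := hB'pos v hv
  have hBa : (B v v : ℂ) = (a : ℂ) := (Complex.conj_eq_iff_re.1 (hBsymm.eq v v)).symm
  have hB'a : (B' v v : ℂ) = (a' : ℂ) := (Complex.conj_eq_iff_re.1 (hB'symm.eq v v)).symm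
  have hc₀eq : c₀ = ((a' / a : ℝ) : ℂ) := by
    have h1 := hc₀ v v
    rw [hBa, hB'a] at h1
    have ha0 : (a : ℂ) ≠ 0 := by exact_mod_cast hapos.ne'
    rw [Complex.ofReal_div, eq_div_iff ha0]
    exact h1.symm
  -- the integrand scales by `(a′/a)²`
  have hint : ∫ x, ‖B' (ρ x v) v‖ ^ 2 ∂ν = (a' / a) ^ 2 * ∫ x, ‖B (ρ x v) v‖ ^ 2 ∂ν := by
    rw [← integral_const_mul]
    refine integral_congr_ae (Filter.Eventually.of_forall fun x => ?_)
    simp only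
    rw [hc₀ (ρ x v) v, hc₀eq, norm_mul, Complex.norm_real, Real.norm_eq_abs, abs_of_pos (div_pos ha'pos hapos)]
    ring
  rw [hint]
  by_cases hI : ∫ x, ‖B (ρ x v) v‖ ^ 2 ∂ν = 0
  · rw [hI]; simp
  · field_simp

omit [TopologicalSpace G] [NonarchimedeanGroup G] [LocallyCompactSpace G] [T2Space G] [MeasurableSpace G] [BorelSpace G] in
/-- **Transport along an equivalence.**  If `φ : ρ ≃ ρ′` is an equivalence of representations and `B′` an invariant positive-definite Hermitian form for `ρ′`, then
the pulled-back form `P v w := B′ (φ v) (φ w)` is an invariant positive-definite Hermitian form for `ρ` (bundled here as `(B′.compl₂ φ).comp φ`), with the SAME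
diagonal coefficient functions: `P (ρ x v) v = B′ (ρ′ x (φ v)) (φ v)`. [folklore] -/
theorem exists_pullback_form {V' : Type*} [AddCommGroup V'] [Module ℂ V'] {ρ' : Representation ℂ G V'} (φ : ρ.Equiv ρ')
    {B' : V' →ₗ⋆[ℂ] V' →ₗ[ℂ] ℂ} (hB'symm : B'.IsSymm) (hB'pos : ∀ v : V', v ≠ 0 → 0 < (B' v v).re)
    (hB'inv : ∀ (g : G) (v w : V'), B' (ρ' g v) (ρ' g w) = B' v w) :
    ∃ P : V →ₗ⋆[ℂ] V →ₗ[ℂ] ℂ, (∀ v w : V, P v w = B' (φ v) (φ w)) ∧ P.IsSymm ∧ (∀ v : V, v ≠ 0 → 0 < (P v v).re) ∧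
      (∀ (g : G) (v w : V), P (ρ g v) (ρ g w) = P v w) ∧
      ∀ (x : G) (v : V), P (ρ x v) v = B' (ρ' x (φ v)) (φ v) := by
  have hφ : ∀ (g : G) (v : V), φ (ρ g v) = ρ' g (φ v) := fun g v => by
    rw [← Representation.Equiv.coe_toIntertwiningMap]
    exact φ.toIntertwiningMap.isIntertwining ρ ρ' g v
  refine ⟨(B'.compl₂ (φ.toLinearEquiv : V →ₗ[ℂ] V')).comp (φ.toLinearEquiv : V →ₗ[ℂ] V'), ?_, ?_, ?_, ?_, ?_⟩
  · intro v w; rfl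
  · exact ⟨fun x y => hB'symm.eq (φ x) (φ y)⟩
  · intro v hv
    have hφv : φ v ≠ 0 := fun h => hv (by simpa using congrArg φ.symm h)
    exact hB'pos (φ v) hφv
  · intro g v w
    show B' (φ (ρ g v)) (φ (ρ g w)) = B' (φ v) (φ w)
    rw [hφ, hφ, hB'inv]
  · intro x v
    show B' (φ (ρ x v)) (φ v) = B' (ρ' x (φ v)) (φ v)
    rw [hφ]

end Generic

/-! ## §2 `U(Φ₃)(L⁺_v)`: the formal degree of a supercuspidal CLASS -/

section CM

variable (L : Type) [Field L] [NumberField L] [IsCMField L] (v : HeightOneSpectrum (𝓞 ↥(maximalRealSubfield L)))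

set_option maxHeartbeats 1600000 in
/-- **THE FORMAL DEGREE OF A SUPERCUSPIDAL CLASS (relative to `νQv`) IS WELL DEFINED.**  On `G = U(Φ₃)(L⁺_v)`, `v` non-split (`hns`; compact centre ★
`isCompact_center_Gqs`, every irreducible smooth representation admissible ★ `isAdmissible_smoothIrrep`, `νQv` inversion-invariant ★ `isInvInvariant_haar_Gqs`), for
every SUPERCUSPIDAL class `π` there is ONE real number `d > 0` such that for EVERY representative `r` of `π`, EVERY invariant positive-definite Hermitian form `B` on
`r.V` and EVERY `v₁ ≠ 0`: `(re B v₁ v₁)² ∕ ∫ ‖B (r.ρ x v₁) v₁‖² dνQv = d` and the normalised coefficient `f_{r,B,v₁} = ((∫ ‖B (r.ρ x v₁) v₁‖² dνQv) ∕ re B v₁ v₁)⁻¹ •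
(g ↦ B (r.ρ g v₁) v₁)` (★ E2-5a) has `f_{r,B,v₁}(1) = d` — Harish-Chandra's «`d(π) > 0` … depending only on the normalization of the Haar measure».
PROOF: fix one datum `(r₀, B₀, v₀)` (★ `exists_invariantForm_of_isSupercuspidal`) and set `d := (re B₀ v₀ v₀)² ∕ ∫ ‖B₀ (r₀.ρ x v₀) v₀‖²`; for any `(r, B, v₁)`
with `IrrClass.mk r = π = IrrClass.mk r₀` take `φ : r.ρ ≃ r₀.ρ` (★ `IrrClass.mk_eq_mk_iff`), pull `B₀` back along `φ` (§1), and chain §1's vector ∕ form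
independence; `f(1) = d` is ★ `inv_smul_sesqForm_apply_self_one`. [cite: HarishChandra1970, Part I §1 Theorem 1 (a)] [cite: Rogawski1990, §12.6 p. 187] -/
theorem exists_formalDegree_of_isSupercuspidal
    (hns : ∀ w : PlacesOver L v, IsCMField.complexConj L • w.1 = w.1)
    [MeasurableSpace (Gqs L v)] [BorelSpace (Gqs L v)] (νQv : Measure (Gqs L v)) [νQv.IsHaarMeasure]
    (π : IrrClass (Gqs L v)) (hπ : π.IsSupercuspidal) :
    ∃ d : ℝ, 0 < d ∧ ∀ (r : SmoothIrrep (Gqs L v)), IrrClass.mk r = π →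
      ∀ (B : r.V →ₗ⋆[ℂ] r.V →ₗ[ℂ] ℂ), B.IsSymm → (∀ w : r.V, w ≠ 0 → 0 < (B w w).re) →
        (∀ (g : Gqs L v) (w w' : r.V), B (r.ρ g w) (r.ρ g w') = B w w') →
        ∀ v₁ : r.V, v₁ ≠ 0 →
          (B v₁ v₁).re ^ 2 / ∫ x, ‖B (r.ρ x v₁) v₁‖ ^ 2 ∂νQv = d ∧
          ((((∫ x, ‖B (r.ρ x v₁) v₁‖ ^ 2 ∂νQv) / (B v₁ v₁).re : ℝ) : ℂ)⁻¹ • fun g => B (r.ρ g v₁) v₁) 1 = (d : ℂ) := by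
  haveI : NonarchimedeanGroup (Gqs L v) := F0P3cStCharTSScTracePackage.nonarchimedeanGroup_Gqs L v
  haveI : νQv.IsInvInvariant := F0P3cStCharTSScTracePackage.isInvInvariant_haar_Gqs L v νQv
  have hZ := F0P3cStCharTSParField.isCompact_center_Gqs L v hns
  -- one datum of the class
  obtain ⟨r₀, rfl⟩ := IrrClass.mk_surjective π
  obtain ⟨B₀, hB₀symm, hB₀pos, hB₀inv⟩ := F0P3cStCharTSScTracePackage.exists_invariantForm_of_isSupercuspidal L v hns r₀ hπ
  haveI : Nontrivial r₀.V := Representation.IsIrreducible.nontrivial r₀.ρ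
  obtain ⟨v₀, hv₀⟩ := exists_ne (0 : r₀.V)
  haveI : r₀.ρ.IsIrreducible := r₀.isIrreducible
  have hsc₀ : r₀.ρ.IsSupercuspidal := (IrrClass.isSupercuspidal_mk r₀).1 hπ
  have hadm₀ : r₀.ρ.IsAdmissible := F0P3cStCharTSScTracePackage.isAdmissible_smoothIrrep L v hns r₀
  refine ⟨(B₀ v₀ v₀).re ^ 2 / ∫ x, ‖B₀ (r₀.ρ x v₀) v₀‖ ^ 2 ∂νQv,
    div_pos (pow_pos (hB₀pos v₀ hv₀) 2) (hsc₀.integral_norm_sq_sesqForm_pos hZ hadm₀.isSmooth hB₀symm hB₀pos hB₀inv νQv hv₀), ?_⟩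
  intro r hr B hBsymm hBpos hBinv v₁ hv₁
  haveI : r.ρ.IsIrreducible := r.isIrreducible
  have hπr : (IrrClass.mk r).IsSupercuspidal := by rw [hr]; exact hπ
  have hsc : r.ρ.IsSupercuspidal := (IrrClass.isSupercuspidal_mk r).1 hπr
  have hadm : r.ρ.IsAdmissible := F0P3cStCharTSScTracePackage.isAdmissible_smoothIrrep L v hns r
  -- an equivalence `φ : r.ρ ≃ r₀.ρ` and the pulled-back form `P = φ^* B₀` on `r.V`
  obtain ⟨φ⟩ := (IrrClass.mk_eq_mk_iff r r₀).1 hr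
  obtain ⟨P, hPapply, hPsymm, hPpos, hPinv, hPcoeff⟩ := exists_pullback_form φ hB₀symm hB₀pos hB₀inv
  have hφv₁ : φ v₁ ≠ 0 := fun h => hv₁ (by simpa using congrArg φ.symm h)
  -- the chain: (B, v₁) = (P, v₁) [form] = (B₀, φ v₁) [transport, literally] = (B₀, v₀) [vector]
  have h1 : (B v₁ v₁).re ^ 2 / ∫ x, ‖B (r.ρ x v₁) v₁‖ ^ 2 ∂νQv = (P v₁ v₁).re ^ 2 / ∫ x, ‖P (r.ρ x v₁) v₁‖ ^ 2 ∂νQv :=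
    formalDegree_eq_of_invariant_forms hadm hBsymm hBpos hBinv hPsymm hPpos hPinv νQv hv₁
  have h2 : (P v₁ v₁).re ^ 2 / ∫ x, ‖P (r.ρ x v₁) v₁‖ ^ 2 ∂νQv =
      (B₀ (φ v₁) (φ v₁)).re ^ 2 / ∫ x, ‖B₀ (r₀.ρ x (φ v₁)) (φ v₁)‖ ^ 2 ∂νQv := by
    rw [hPapply]
    simp_rw [hPcoeff]
  have h3 : (B₀ (φ v₁) (φ v₁)).re ^ 2 / ∫ x, ‖B₀ (r₀.ρ x (φ v₁)) (φ v₁)‖ ^ 2 ∂νQv =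
      (B₀ v₀ v₀).re ^ 2 / ∫ x, ‖B₀ (r₀.ρ x v₀) v₀‖ ^ 2 ∂νQv :=
    formalDegree_eq_of_ne_zero hadm₀ hsc₀ hZ hB₀symm hB₀pos hB₀inv νQv hφv₁ hv₀
  have hval : (B v₁ v₁).re ^ 2 / ∫ x, ‖B (r.ρ x v₁) v₁‖ ^ 2 ∂νQv = (B₀ v₀ v₀).re ^ 2 / ∫ x, ‖B₀ (r₀.ρ x v₀) v₀‖ ^ 2 ∂νQv := by
    rw [h1, h2, h3]
  refine ⟨hval, ?_⟩
  rw [(hsc.inv_smul_sesqForm_apply_self_one hZ hadm.isSmooth hBsymm hBpos hBinv νQv hv₁).1, hval]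

end CM

end Summit.HodgeConjecture.HodgeConjecture.Cruxes.H413.K2E3FormalDegreeSupercuspidalWellDefined

end
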